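import Summits.RiemannHypothesis.RiemannHypothesis.Theorems.Splittings.LiDifferenceOrderLawRH
import HarnessLib

/-!
# The DIFFERENCE-ORDER LAW, unconditionally: every forward difference of order `K ≥ 2` of Li's coefficients takes both signs on a syndetic set; counting form; no limit (SketchG7 §5c–§5e)

Cell rh-split, seat rh-split-li-bridge g7 (brief sha16 f79c5f09d8bcb036), card `run/shared/lean/pub/rh-split/cards/SPLIT-li-bridge.md` §14
(referee rh-split-ref g5: REPLAY PASS of v1 353a9a80816aea0e + v2 ca059ef508c1d3b5, 08:37:53Z; labels L1–L4 there); kernel source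
`HOME/rh-split-li-bridge/SketchG7.lean` sha16 dac2b83ce457a730 (1546 l; = v2 + §5e `not_tendsto_liSecondDiff/_liFdiff` + 28 one-line docstrings,
no decl text changed).  Cut by the seat (lead RULING #60, lane (xi-g)) into SIX tree modules at the scratch's section boundaries, decl text
byte-verbatim; deltas = namespace `RhSplit.LiBridgeG7` ↦ `…Theorems.Splittings.{LiWindowComplex, LiCurvatureSignChanges, LiDifferenceOrderLaw}`
(+ `open` of the earlier namespaces of the chain), module docstrings, and the variable-free wrapper `section HigherOrder … end HigherOrder`
dropped.  END-TO-END statement of the chain (last file): `LiDifferenceOrderLaw.liFdiff_signs_syndetic (hK : 2 ≤ K) :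
∃ η > 0, ∃ L, ∀ N, (∃ n ∈ Ico N (N+L), fdiff K keiperLiCoeff n ≤ −η) ∧ (∃ n ∈ Ico N (N+L), η ≤ fdiff K keiperLiCoeff n)` — every forward
difference of order `K ≥ 2` of Li's coefficients (K = 2: the curvature `d_n = λ_{n+2} − 2λ_{n+1} + λ_n`, file `LiCurvatureSignChanges`) takes
BOTH signs with a margin on a syndetic set, UNCONDITIONALLY (proof by cases on `RiemannHypothesis`; an RH-free kernel theorem about `λ_n`
alone, referee label L1; certifies nothing about RH; class (li, bridge) unchanged).

This file: §5c (`Classical.em RH`): `liFdiff_signs_syndetic (hK : 2 ≤ K)`, `fdiff_two_keiperLi` (K = 2 is the curvature), `not_eventually_fdiff_nonneg/_nonpos`,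
`not_fdiff_nonneg/_nonpos_on_thick`; §5d COUNTING FORM: pure `card_filter_range_ge_of_windows/_ge_div` and `liSecondDiff_sign_sets_lower_density`,
`liFdiff_sign_sets_lower_density (hK : 2 ≤ K) : ∃ L ≥ 1, ∀ N, N/L ≤ #{n < N : Δ^K λ n < 0} ∧ N/L ≤ #{n < N : 0 < Δ^K λ n}` (both sign sets of every order ≥ 2
have POSITIVE LOWER DENSITY — contrast ORDER 1, whose descent set has density ZERO under RH, tree `LiIncrBlockLawOfRH`); §5e NO LIMIT:
`not_tendsto_liSecondDiff (c)`, `not_tendsto_liFdiff (hK : 2 ≤ K) (c)` (RH-FREE KERNEL THEOREMS, label L1 for §5c/§5d; §5e same class pending the referee).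

HONEST LABEL: «SPLITTING SEARCH over kernel-typed RH-EQUIVALENCES; a splitting A ∧ B ⟹ RH is CONDITIONAL bookkeeping unless A and B are
both proved; nothing here bears on the truth of RH.»
-/

set_option linter.dupNamespace false

noncomputable section

namespace Summit.RiemannHypothesis.RiemannHypothesis.Theorems.Splittings.LiDifferenceOrderLaw

open Complex Filter Topology Finset
open scoped Real ComplexConjugate
open Literature.NumberTheory.LFunctions
open Summit.RiemannHypothesis.RiemannHypothesis.Theorems.Splittings
open Summit.RiemannHypothesis.RiemannHypothesis.Theorems.Splittings.LiIndexSets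
open Summit.RiemannHypothesis.RiemannHypothesis.Theorems.Splittings.LiExtremalLayer
open Summit.RiemannHypothesis.RiemannHypothesis.Theorems.Splittings.LiSecondOrderCriterion
open Summit.RiemannHypothesis.RiemannHypothesis.Theorems.Splittings.LiWindowComplex
open Summit.RiemannHypothesis.RiemannHypothesis.Theorems.Splittings.LiCurvatureSignChanges

/-! ### §5c Unconditional: the difference-order law -/

/-- **Every order `K ≥ 2` is two-signed with a margin on a syndetic set, unconditionally.** -/
theorem liFdiff_signs_syndetic {K : ℕ} (hK : 2 ≤ K) :
    ∃ η : ℝ, 0 < η ∧ ∃ L : ℕ, ∀ N : ℕ,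
      (∃ n ∈ Ico N (N + L), fdiff K keiperLiCoeff n ≤ -η) ∧
      (∃ n ∈ Ico N (N + L), η ≤ fdiff K keiperLiCoeff n) := by
  by_cases hRH : RiemannHypothesis
  · obtain ⟨η, hη, L, hL⟩ := liFdiff_two_signs_of_rh hRH hK
    refine ⟨η, hη, L + 1, fun N ↦ ⟨?_, ?_⟩⟩
    · obtain ⟨n, hn, h⟩ := (hL (N + 1) (by omega)).2
      rw [Finset.mem_Ico] at hn
      exact ⟨n, Finset.mem_Ico.2 ⟨by omega, by omega⟩, h⟩
    · obtain ⟨n, hn, h⟩ := (hL (N + 1) (by omega)).1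
      rw [Finset.mem_Ico] at hn
      exact ⟨n, Finset.mem_Ico.2 ⟨by omega, by omega⟩, h⟩
  · obtain ⟨k, rfl⟩ : ∃ k, K = k + 1 := ⟨K - 1, by omega⟩
    obtain ⟨L, n₁, hL⟩ := liFdiff_two_signs_of_not_rh hRH k zero_le_one
    refine ⟨1, one_pos, L + n₁, fun N ↦ ⟨?_, ?_⟩⟩
    · obtain ⟨n, hn, h⟩ := (hL (N + n₁) (by omega)).1
      rw [Finset.mem_Ico] at hn
      exact ⟨n, Finset.mem_Ico.2 ⟨by omega, by omega⟩, h.le⟩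
    · obtain ⟨n, hn, h⟩ := (hL (N + n₁) (by omega)).2
      rw [Finset.mem_Ico] at hn
      exact ⟨n, Finset.mem_Ico.2 ⟨by omega, by omega⟩, h.le⟩

/-- no difference of order `≥ 2` is eventually non-negative … -/
theorem not_eventually_fdiff_nonneg {K : ℕ} (hK : 2 ≤ K) (n₀ : ℕ) :
    ∃ n : ℕ, n₀ ≤ n ∧ fdiff K keiperLiCoeff n < 0 := by
  obtain ⟨η, hη, L, hL⟩ := liFdiff_signs_syndetic hK
  obtain ⟨n, hn, h⟩ := (hL n₀).1
  exact ⟨n, (Finset.mem_Ico.1 hn).1, by linarith⟩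

/-- … nor eventually non-positive -/
theorem not_eventually_fdiff_nonpos {K : ℕ} (hK : 2 ≤ K) (n₀ : ℕ) :
    ∃ n : ℕ, n₀ ≤ n ∧ 0 < fdiff K keiperLiCoeff n := by
  obtain ⟨η, hη, L, hL⟩ := liFdiff_signs_syndetic hK
  obtain ⟨n, hn, h⟩ := (hL n₀).2
  exact ⟨n, (Finset.mem_Ico.1 hn).1, by linarith⟩

/-- … nor of one sign on a thick set -/
theorem not_fdiff_nonneg_on_thick {K : ℕ} (hK : 2 ≤ K) {S : Set ℕ} (hS : IsThick S) :
    ¬ ∀ n ∈ S, 0 ≤ fdiff K keiperLiCoeff n := by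
  intro h
  obtain ⟨η, hη, L, hL⟩ := liFdiff_signs_syndetic hK
  obtain ⟨a, ha⟩ := hS L
  obtain ⟨n, hn, hneg⟩ := (hL a).1
  rw [Finset.mem_Ico] at hn
  obtain ⟨t, rfl⟩ := Nat.exists_eq_add_of_le hn.1
  have := h (a + t) (ha t (by omega))
  linarith

/-- No difference of order `K ≥ 2` of `λ_n` is `≤ 0` on all of a thick set, unconditionally. -/
theorem not_fdiff_nonpos_on_thick {K : ℕ} (hK : 2 ≤ K) {S : Set ℕ} (hS : IsThick S) :
    ¬ ∀ n ∈ S, fdiff K keiperLiCoeff n ≤ 0 := by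
  intro h
  obtain ⟨η, hη, L, hL⟩ := liFdiff_signs_syndetic hK
  obtain ⟨a, ha⟩ := hS L
  obtain ⟨n, hn, hpos⟩ := (hL a).2
  rw [Finset.mem_Ico] at hn
  obtain ⟨t, rfl⟩ := Nat.exists_eq_add_of_le hn.1
  have := h (a + t) (ha t (by omega))
  linarith

/-- consistency: order 2 of §5 is the curvature of §§2–4 -/
theorem fdiff_two_keiperLi (n : ℕ) :
    fdiff 2 keiperLiCoeff n = keiperLiCoeff (n + 2) - 2 * keiperLiCoeff (n + 1) + keiperLiCoeff n :=
  fdiff_two_real _ _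

/-- Under ¬RH even ORDER 0 and ORDER 1 are two-signed in late windows (all orders `k+1` by
`liFdiff_two_signs_of_not_rh`, order 0 by the tree) — recorded here as the order-1 instance with margin. -/
theorem liIncr_two_signs_of_not_rh (hRH : ¬ RiemannHypothesis) {η : ℝ} (hη : 0 ≤ η) :
    ∃ L n₁ : ℕ, ∀ a : ℕ, n₁ ≤ a →
      (∃ n ∈ Ico a (a + L), keiperLiCoeff (n + 1) - keiperLiCoeff n < -η) ∧
      (∃ n ∈ Ico a (a + L), η < keiperLiCoeff (n + 1) - keiperLiCoeff n) :=
  liFdiff_two_signs_of_not_rh hRH 0 hη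

/-! ### §5d Counting form: both sign sets of `Δ^K λ` (`K ≥ 2`) have POSITIVE LOWER DENSITY, unconditionally
(contrast ORDER 1: the descent set has density ZERO under RH — T-Li3 — and positive lower density under ¬RH). -/

/-- pure: a predicate met in every window `[a, a+L)` holds at `≥ k` points below `k·L`. -/
theorem card_filter_range_ge_of_windows {P : ℕ → Prop} [DecidablePred P] {L : ℕ}
    (hwin : ∀ a : ℕ, ∃ n ∈ Ico a (a + L), P n) (k : ℕ) :
    k ≤ ((Finset.range (k * L)).filter P).card := by
  induction k with
  | zero => exact Nat.zero_le _
  | succ k ih =>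
    obtain ⟨n, hn, hP⟩ := hwin (k * L)
    rw [Finset.mem_Ico] at hn
    have hnot : n ∉ (Finset.range (k * L)).filter P := by
      rw [Finset.mem_filter, Finset.mem_range]
      omega
    have hsub : insert n ((Finset.range (k * L)).filter P) ⊆ (Finset.range ((k + 1) * L)).filter P := by
      intro x hx
      rw [Finset.mem_insert] at hx
      rw [Finset.mem_filter, Finset.mem_range, add_one_mul]
      rcases hx with rfl | hx
      · exact ⟨by omega, hP⟩
      · rw [Finset.mem_filter, Finset.mem_range] at hx
        exact ⟨by omega, hx.2⟩
    have := Finset.card_le_card hsub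
    rw [Finset.card_insert_of_notMem hnot] at this
    omega

/-- pure: … hence at `≥ N/L` (ℕ-division) points below every `N`. -/
theorem card_filter_range_ge_div {P : ℕ → Prop} [DecidablePred P] {L : ℕ}
    (hwin : ∀ a : ℕ, ∃ n ∈ Ico a (a + L), P n) (N : ℕ) :
    N / L ≤ ((Finset.range N).filter P).card :=
  (card_filter_range_ge_of_windows hwin (N / L)).trans
    (Finset.card_le_card (Finset.filter_subset_filter P (Finset.range_subset_range.2 (Nat.div_mul_le_self N L))))

/-- **Both curvature-sign sets have positive lower density, unconditionally:** there is `L ≥ 1` with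
`#{n < N : d_n < 0} ≥ N/L` and `#{n < N : d_n > 0} ≥ N/L` for every `N` (ℕ-division). -/
theorem liSecondDiff_sign_sets_lower_density :
    ∃ L : ℕ, 1 ≤ L ∧ ∀ N : ℕ,
      N / L ≤ ((Finset.range N).filter
        (fun n ↦ keiperLiCoeff (n + 2) - 2 * keiperLiCoeff (n + 1) + keiperLiCoeff n < 0)).card ∧
      N / L ≤ ((Finset.range N).filter
        (fun n ↦ 0 < keiperLiCoeff (n + 2) - 2 * keiperLiCoeff (n + 1) + keiperLiCoeff n)).card := by
  obtain ⟨η, hη, L, hL⟩ := liSecondDiff_signs_syndetic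
  have hL1 : 1 ≤ L := by
    obtain ⟨n, hn, -⟩ := (hL 0).1
    rw [Finset.mem_Ico] at hn
    omega
  refine ⟨L, hL1, fun N ↦ ⟨card_filter_range_ge_div (fun a ↦ ?_) N, card_filter_range_ge_div (fun a ↦ ?_) N⟩⟩
  · obtain ⟨n, hn, h⟩ := (hL a).1
    exact ⟨n, hn, by linarith⟩
  · obtain ⟨n, hn, h⟩ := (hL a).2
    exact ⟨n, hn, by linarith⟩

/-- **Every order `K ≥ 2`: both sign sets of `Δ^K λ` have positive lower density, unconditionally.** -/
theorem liFdiff_sign_sets_lower_density {K : ℕ} (hK : 2 ≤ K) :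
    ∃ L : ℕ, 1 ≤ L ∧ ∀ N : ℕ,
      N / L ≤ ((Finset.range N).filter (fun n ↦ fdiff K keiperLiCoeff n < 0)).card ∧
      N / L ≤ ((Finset.range N).filter (fun n ↦ 0 < fdiff K keiperLiCoeff n)).card := by
  obtain ⟨η, hη, L, hL⟩ := liFdiff_signs_syndetic hK
  have hL1 : 1 ≤ L := by
    obtain ⟨n, hn, -⟩ := (hL 0).1
    rw [Finset.mem_Ico] at hn
    omega
  refine ⟨L, hL1, fun N ↦ ⟨card_filter_range_ge_div (fun a ↦ ?_) N, card_filter_range_ge_div (fun a ↦ ?_) N⟩⟩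
  · obtain ⟨n, hn, h⟩ := (hL a).1
    exact ⟨n, hn, by linarith⟩
  · obtain ⟨n, hn, h⟩ := (hL a).2
    exact ⟨n, hn, by linarith⟩

/-! ### §5e No limit: `d_n` and every `Δ^K λ` (`K ≥ 2`) DIVERGE (no finite limit), unconditionally
(card V43: «d_n → 0» is false outright, not RH-hard). -/

/-- **The curvature sequence has no limit** (in particular `d_n ↛ 0`), unconditionally. -/
theorem not_tendsto_liSecondDiff (c : ℝ) :
    ¬ Tendsto (fun n : ℕ ↦ keiperLiCoeff (n + 2) - 2 * keiperLiCoeff (n + 1) + keiperLiCoeff n)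
      atTop (𝓝 c) := by
  intro h
  obtain ⟨η, hη, L, hL⟩ := liSecondDiff_signs_syndetic
  have h1 : ∀ᶠ n : ℕ in atTop,
      c - η < keiperLiCoeff (n + 2) - 2 * keiperLiCoeff (n + 1) + keiperLiCoeff n :=
    h.eventually (eventually_gt_nhds (by linarith))
  have h2 : ∀ᶠ n : ℕ in atTop,
      keiperLiCoeff (n + 2) - 2 * keiperLiCoeff (n + 1) + keiperLiCoeff n < c + η :=
    h.eventually (eventually_lt_nhds (by linarith))
  obtain ⟨N₀, hN₀⟩ := eventually_atTop.1 (h1.and h2)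
  obtain ⟨n, hn, hle⟩ := (hL N₀).1
  obtain ⟨m, hm, hge⟩ := (hL N₀).2
  have hn' := (hN₀ n (Finset.mem_Ico.1 hn).1).1
  have hm' := (hN₀ m (Finset.mem_Ico.1 hm).1).2
  linarith

/-- **No difference of order `K ≥ 2` of `λ_n` has a limit**, unconditionally. -/
theorem not_tendsto_liFdiff {K : ℕ} (hK : 2 ≤ K) (c : ℝ) :
    ¬ Tendsto (fun n : ℕ ↦ fdiff K keiperLiCoeff n) atTop (𝓝 c) := by
  intro h
  obtain ⟨η, hη, L, hL⟩ := liFdiff_signs_syndetic hK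
  have h1 : ∀ᶠ n : ℕ in atTop, c - η < fdiff K keiperLiCoeff n :=
    h.eventually (eventually_gt_nhds (by linarith))
  have h2 : ∀ᶠ n : ℕ in atTop, fdiff K keiperLiCoeff n < c + η :=
    h.eventually (eventually_lt_nhds (by linarith))
  obtain ⟨N₀, hN₀⟩ := eventually_atTop.1 (h1.and h2)
  obtain ⟨n, hn, hle⟩ := (hL N₀).1
  obtain ⟨m, hm, hge⟩ := (hL N₀).2
  have hn' := (hN₀ n (Finset.mem_Ico.1 hn).1).1
  have hm' := (hN₀ m (Finset.mem_Ico.1 hm).1).2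
  linarith

end Summit.RiemannHypothesis.RiemannHypothesis.Theorems.Splittings.LiDifferenceOrderLaw

end
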